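import Mathlib.LinearAlgebra.CrossProduct
import Mathlib.Analysis.Calculus.Deriv.Basic
import Mathlib.Analysis.Complex.Basic
import Mathlib.Order.Interval.Set.OrdConnected
import HarnessLib

/-!
# Kishimoto–Yoneda: rigidity of 3D Euler flows supported on finitely many Fourier modes

A NAMED FACT (D-0014, statement only):

* `KishimotoYoneda2022_finiteMode_rigidity` — N. Kishimoto, T. Yoneda, *Characterization of
  three-dimensional Euler flows supported on finitely many Fourier modes*, J. Math. Fluid Mech. 24
  (2022) (= arXiv:2110.08039, held text), **Theorem 1.4**, in the following WEAKENED form (every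
  clause below is implied by the printed classification; the fine structure of the planar case
  (ii) is dropped): a real-valued, mean-zero, divergence-free velocity field
  `u(t,x) = Σ_{n ∈ S} u_n(t) e^{i n·x}` with FINITE symmetric Fourier support `S ⊂ ℝ³ ∖ {0}`
  (no lattice assumption) which solves the incompressible Euler equations on an open time
  interval is INDEPENDENT OF TIME, and either `S` lies in a plane through the origin (cases (i),
  (ii) of the theorem) or `S` lies on a sphere centred at the origin and `u` is a Beltrami flow
  (case (iii): "`S` has three linearly independent points and is a subset of a sphere centered at
  the origin, and `u(x)` is a Beltrami flow"). Abstract: "there is no 3D Euler flows with finitely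
  many Fourier modes, except for stationary 2D-like flows and Beltrami flows."

## The printed objects (§1) and their rendering

* `ℋ_I` (Def. 1.1): `u(t,x) = Σ_{n∈S} u_n(t) e^{in·x}`, `S ⊂ ℝ³∖{0}` finite and symmetric,
  `u_n : I → ℂ³`, `u_n ≢ 0`, `u_{-n} = conj(u_n)`, `n · u_n = 0` ("·" the `ℂ`-BILINEAR dot product).
  Here: `S : Finset (Fin 3 → ℝ)`, coefficients `u : (Fin 3 → ℝ) → ℝ → (Fin 3 → ℂ)` extended by
  `0` off `S` ("we use the convention that `u_n = 0` if `n ∉ S`") and arbitrary off `I`.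
* The Euler equations on the Fourier side, (1.3) = (cond:Euler):
  `∂_t u_n + (i/2) P̂_n Σ_{n₁+n₂=n, nᵢ∈S} [(u_{n₁}·n₂) u_{n₂} + (u_{n₂}·n₁) u_{n₁}] = 0`, `P̂_n` the
  orthogonal projection of `ℂ³` onto `{v : n·v = 0}` (`KY.proj`, `v ↦ v − (n·v/|n|²) n`); imposed
  here for EVERY frequency `n ≠ 0` with the zero extension (for `n ∉ S` this is the vanishing of
  the projected interaction at unoccupied modes, which a genuine solution of Euler satisfies;
  imposing it is a stronger hypothesis than the display "`n ∈ S`", hence a weaker statement).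
  Differentiability in `t` on `I` is assumed (the coefficients are in fact real analytic in `t`).
* "open interval `I`": `IsOpen I ∧ I.OrdConnected ∧ I.Nonempty` (possibly unbounded).
* "independent of time": `u_n` constant on `I`; "subset of a plane containing the origin":
  `∃ a ≠ 0, ∀ n ∈ S, a·n = 0`; "subset of a sphere centered at the origin": all `|n|²` equal;
  "Beltrami flow" (`∇ × b = λ b`, `λ ∈ ℝ ∖ {0}`, Lemma 1.2): `i (n × u_n) = λ u_n` for all `n ∈ S`
  (Mathlib `crossProduct` on `Fin 3 → ℂ`).
* NOT vendored: the converse direction (all listed fields are solutions), the sub-cases (ii)(a),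
  (ii)(b) (`u = u^∥ + Q(ω) e^⊥`, circle support with `≥ 4` points), Lemma 2.1 / Prop. 2.2 (pair
  interaction formula and criterion), and Thm. 5.1 (Navier–Stokes–Coriolis with fractional
  dissipation). 2D predecessor: Elgindi–Hu–Šverák 2017 (Thm. 1.3 in the paper).

## References

* [KishimotoYoneda2022] N. Kishimoto, T. Yoneda, J. Math. Fluid Mech. 24 (2022), Paper 74;
  arXiv:2110.08039: §1 Def. 1.1, (1.3), Lemma 1.2, Thm. 1.4.
-/

noncomputable section

open scoped BigOperators
open Finset

namespace Literature.Analysis.FluidPDE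

namespace KY

/-- A real frequency `n ∈ ℝ³` viewed in `ℂ³`. [cite: KishimotoYoneda2022, §1 Def. 1.1] -/
def cplx (n : Fin 3 → ℝ) : Fin 3 → ℂ := fun i => (n i : ℂ)

/-- The `ℂ`-bilinear dot product on `ℂ³` ("it is `ℂ`-bilinear and different from the inner product
of `ℂ³` which is sesquilinear"). [cite: KishimotoYoneda2022, §1 Def. 1.1] -/
def dot (a b : Fin 3 → ℂ) : ℂ := ∑ i, a i * b i

/-- `P̂_n`, the projection of `ℂ³` onto `{v : n·v = 0}` along `n` (for real `n ≠ 0` this is the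
orthogonal projection; the Helmholtz projection on the Fourier side): `v ↦ v − (n·v / n·n) n`.
[cite: KishimotoYoneda2022, §1 (before (1.3))] -/
def proj (n : Fin 3 → ℝ) (v : Fin 3 → ℂ) : Fin 3 → ℂ :=
  v - (dot (cplx n) v / dot (cplx n) (cplx n)) • cplx n

open scoped Classical in
/-- The Fourier-side Euler nonlinearity at frequency `n` of a coefficient family `c` with finite
support `S`: `(i/2) P̂_n Σ_{n₁,n₂ ∈ S, n₁+n₂=n} [(c_{n₁}·n₂) c_{n₂} + (c_{n₂}·n₁) c_{n₁}]`.
[cite: KishimotoYoneda2022, §1 (1.3)] -/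
def nonlin (S : Finset (Fin 3 → ℝ)) (c : (Fin 3 → ℝ) → (Fin 3 → ℂ)) (n : Fin 3 → ℝ) : Fin 3 → ℂ :=
  (Complex.I / 2) • proj n
    (∑ q ∈ S ×ˢ S,
      if q.1 + q.2 = n then (dot (c q.1) (cplx q.2)) • c q.2 + (dot (c q.2) (cplx q.1)) • c q.1 else 0)

/-- `u ∈ ℋ_I` solving the Fourier-side Euler system (1.3) on the open interval `I` with Fourier
support exactly `S` (Kishimoto–Yoneda Def. 1.1 and (cond:Euler)); see the module docstring for
each clause. [cite: KishimotoYoneda2022, §1 Def. 1.1 and (1.3)] -/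
structure IsFiniteModeEulerSolution (I : Set ℝ) (S : Finset (Fin 3 → ℝ))
    (u : (Fin 3 → ℝ) → ℝ → (Fin 3 → ℂ)) : Prop where
  /-- `I` is an open interval (possibly unbounded). -/
  isOpen : IsOpen I
  /-- `I` is an interval. -/
  ordConnected : I.OrdConnected
  /-- `I` is nonempty. -/
  nonempty : I.Nonempty
  /-- the zero frequency is excluded (mean-zero solutions). -/
  zero_notMem : (0 : Fin 3 → ℝ) ∉ S
  /-- `S` is symmetric: `-S = S`. -/
  neg_mem : ∀ n ∈ S, -n ∈ S
  /-- zero extension off `S` ("`u_n = 0` if `n ∉ S`"). -/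
  eq_zero_of_notMem : ∀ n ∉ S, ∀ t, u n t = 0
  /-- each occupied mode is not identically zero on `I` (`u_n ≢ 0`). -/
  exists_ne_zero : ∀ n ∈ S, ∃ t ∈ I, u n t ≠ 0
  /-- real-valuedness: `u_{-n} = conj u_n`. -/
  conj : ∀ n t, u (-n) t = star (u n t)
  /-- divergence-free: `n · u_n = 0`. -/
  div_free : ∀ n ∈ S, ∀ t ∈ I, dot (cplx n) (u n t) = 0
  /-- the coefficients are differentiable in time on `I`. -/
  differentiableOn : ∀ n, ∀ i : Fin 3, DifferentiableOn ℝ (fun t => u n t i) I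
  /-- the Euler equations (1.3) at every nonzero frequency. -/
  euler : ∀ n : Fin 3 → ℝ, n ≠ 0 → ∀ t ∈ I, ∀ i : Fin 3,
    deriv (fun s => u n s i) t + nonlin S (fun m => u m t) n i = 0

end KY

/-- **Kishimoto–Yoneda 2022, Theorem 1.4 (weakened form): finite-mode 3D Euler flows are
stationary, and are planar-supported or Beltrami.** If `u(t,x) = Σ_{n∈S} u_n(t) e^{in·x}` is a
real-valued, mean-zero, divergence-free solution of the 3D incompressible Euler equations on an
open time interval `I` with finite symmetric Fourier support `S ⊂ ℝ³ ∖ {0}`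
(`KY.IsFiniteModeEulerSolution`), then (a) every coefficient `u_n` is constant on `I` ("`u` … is a
solution … if and only if it is independent of time and satisfies one of (i)–(iii)"), and (b) either
`S` is contained in a plane through the origin (cases (i), (ii)), or `S` is contained in a sphere
centred at the origin and `u` is a Beltrami flow, `i (n × u_n) = λ u_n` for some real `λ ≠ 0` and
all `n ∈ S` (case (iii) with Lemma 1.2). The printed theorem is an "iff" with a complete description
of case (ii); only these consequences are stated. [cite: KishimotoYoneda2022, Thm. 1.4 (with Def. 1.1, (1.3), Lemma 1.2)] -/
def KishimotoYoneda2022_finiteMode_rigidity : Prop :=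
  ∀ (I : Set ℝ) (S : Finset (Fin 3 → ℝ)) (u : (Fin 3 → ℝ) → ℝ → (Fin 3 → ℂ)),
    KY.IsFiniteModeEulerSolution I S u →
      (∀ n, ∀ t ∈ I, ∀ s ∈ I, u n t = u n s) ∧
        ((∃ a : Fin 3 → ℝ, a ≠ 0 ∧ ∀ n ∈ S, ∑ i, a i * n i = 0) ∨
          ((∃ r : ℝ, ∀ n ∈ S, ∑ i, n i ^ 2 = r) ∧
            ∃ lam : ℝ, lam ≠ 0 ∧ ∀ n ∈ S, ∀ t ∈ I,
              Complex.I • crossProduct (KY.cplx n) (u n t) = (lam : ℂ) • u n t))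

/-- Unfolding lemma. [cite: KishimotoYoneda2022, Thm. 1.4] -/
theorem KishimotoYoneda2022_finiteMode_rigidity_iff :
    KishimotoYoneda2022_finiteMode_rigidity ↔
      ∀ (I : Set ℝ) (S : Finset (Fin 3 → ℝ)) (u : (Fin 3 → ℝ) → ℝ → (Fin 3 → ℂ)),
        KY.IsFiniteModeEulerSolution I S u →
          (∀ n, ∀ t ∈ I, ∀ s ∈ I, u n t = u n s) ∧
            ((∃ a : Fin 3 → ℝ, a ≠ 0 ∧ ∀ n ∈ S, ∑ i, a i * n i = 0) ∨
              ((∃ r : ℝ, ∀ n ∈ S, ∑ i, n i ^ 2 = r) ∧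
                ∃ lam : ℝ, lam ≠ 0 ∧ ∀ n ∈ S, ∀ t ∈ I,
                  Complex.I • crossProduct (KY.cplx n) (u n t) = (lam : ℂ) • u n t)) :=
  Iff.rfl

/-- Sanity (non-vacuity of the hypothesis structure's frame conditions): the empty support with the
zero family on `I = ℝ` is a finite-mode Euler solution (the trivial flow `u = 0`).
[cite: KishimotoYoneda2022, §1 Def. 1.1] -/
theorem KY.isFiniteModeEulerSolution_zero :
    KY.IsFiniteModeEulerSolution Set.univ ∅ (fun _ _ => 0) where
  isOpen := isOpen_univ
  ordConnected := Set.ordConnected_univ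
  nonempty := Set.univ_nonempty
  zero_notMem := by simp
  neg_mem := by simp
  eq_zero_of_notMem := fun _ _ _ => rfl
  exists_ne_zero := by simp
  conj := fun _ _ => by simp
  div_free := by simp
  differentiableOn := fun _ _ => differentiableOn_const 0
  euler := by
    intro n _ t _ i
    simp [KY.nonlin, KY.proj, KY.dot]

end Literature.Analysis.FluidPDE

end
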